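import Summits.AtomisticToContinuum.HydrodynamicLimit.Theorems.BoxDissipativeWeakStrongRelativeEnergyStabilityGronwallIntegrablePieces
import Summits.AtomisticToContinuum.HydrodynamicLimit.Theorems.BoxDissipativeWeakStrongRelativeEnergyStabilityCoercivePointwise
import HarnessLib

/-!
# Crux `RelativeEnergyStability` (stmt-AtomisticToContinuum-17653), line `registered`, heart stub S-X — part 9c:
# the uniform master constant on `[0,τ]`

`sx_master_constant`: for the strong solution (hypothesis conjunction `S` of part 2), admissible deep clamps on `[0,τ]`
(`ClampAdmissible σ η₁ a b ρ θ τ`), BF's abstract master inequality for the cut law (`CutEosMasterFor σ η₁`, stub S-M)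
and the three smallness facts of the coercivity lemma (`co_coercive_on_compact`), there are `C ≥ 0` and `ρs > 0` with
`reducedRHS ≤ C · ℰ_{Z_{a,b}}` at every point datum `pdAt T ρ u θ (s,x)`, `s ∈ [0,τ]`, and every state that is vacuum,
hot (open quadrant) or a small frozen box (`ien = 0`, `dens ≤ ρs`). This is exactly the `hmaster` hypothesis of the
pathwise inequality `sx_pathwise` (part 8b), uniformly on `[0,τ]`.

Constants: the compact thermo range `K` of `(ρ,θ)` on `[0,τ] × 𝕋³` (`isCompact_range_thermo`), the point-data bound `M`
(`exists_bound_pointData`), the master constant on `K` (`CutEosMasterFor`), nonnegativity of the clamped energy on `K`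
(`co_coercive_on_compact`), the frozen-box constant (`sx_reduced_le_frozen`) with `Sk` from sup bounds of `s, ∂p` of the
smooth band extension on `K` (transferred to the cut law by `sx_pd_transfer`) and `pmin = min_K p > 0`.

References: Březina–Feireisl 2018 §3.2.2 (3.9)–(3.11).
-/

noncomputable section

namespace Summit.AtomisticToContinuum.HydrodynamicLimit.Theorems.RES

open MeasureTheory Filter Set Function
open scoped Topology InnerProductSpace ENNReal
open Summit.AtomisticToContinuum.HydrodynamicLimit.Theses.BoxDissipativeWeakStrong
open Literature.MathematicalPhysics.KineticTheory Literature.Analysis.FluidPDE Literature.Analysis.FunctionSpaces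
open Literature.Analysis.FluidPDE.CompressibleEuler
open Literature.Analysis.FluidPDE.CompressibleEuler.EulerPhase
open Literature.Analysis.FluidPDE.CompressibleEuler.StrongPointData
open Literature.Analysis.FluidPDE.CompressibleEuler.EulerEOS (exists_nonneg_forall_abs_le_of_continuousOn)

section Strong

variable {η₀ η₁ η₁B σ T : ℝ} {F χ f : ℝ → ℝ} {ρ θ : ℝ → T3 → ℝ} {u : ℝ → T3 → V3}

variable (S : AnalyticOnNhd ℝ F (Ioo (-η₀) η₀) ∧ EqOn hsExcessFreeEnergy F (Ico 0 η₀) ∧ 0 < η₁ ∧ η₁ ≤ η₁B ∧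
  2 * η₁B < η₀ ∧ 0 < σ ∧
  (∀ x, 0 < x → x * σ ^ 3 ≤ η₁B → f x = hsExcessFreeEnergy (x * σ ^ 3) ∧ χ x = hsCompressibility (x * σ ^ 3)) ∧
  (EulerEOS.monatomicExcess χ f).IsGibbs ∧ IsHardSphereEulerSolution σ T ρ u θ ∧
  ∀ t ∈ Ico 0 T, ∀ x, ρ t x * σ ^ 3 ≤ η₁ / 2)
include S

omit S in
/-- The clamped relative energy at a point datum depends only on `(r, U, Θ)`: `pdAt` and `strongData` agree. -/
theorem sx_relEnergyZ_pdAt (Z : ℝ → ℝ) (s : ℝ) (x : T3) (v : EulerPhase) :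
    (pdAt T ρ u θ (s, x)).relEnergyZ (cutEOS σ η₁) Z v =
      (strongData (ρ s x) (u s x) (θ s x)).relEnergyZ (cutEOS σ η₁) Z v := by
  simp only [strongData, pdAt, classicalPointData, StrongPointData.relEnergyZ]

/-- **The uniform master constant on `[0,τ]`** (vacuum / hot / small frozen states). -/
theorem sx_master_constant (HM : CutEosMasterFor σ η₁)
    (hW' : ∀ η ∈ Ioo 0 η₁, (1 / 2 : ℝ) ≤ 1 + 2 * η * deriv F η + η ^ 2 * deriv (deriv F) η)
    (hZ1 : (1 / 2 : ℝ) ≤ 1 + η₁ * deriv F η₁) (hZpos : ∀ η, 0 < η → 0 < cutCompressibility η₁ η)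
    {τ : ℝ} (hτ : τ ∈ Ico 0 T) {a b : ℝ} (hadm : ClampAdmissible σ η₁ a b ρ θ τ) :
    ∃ C ρs : ℝ, 0 ≤ C ∧ 0 < ρs ∧ ∀ s ∈ Icc 0 τ, ∀ (x : T3) (v : EulerPhase),
      (v = 0 ∨ (0 < dens v ∧ 0 < ien v) ∨ (0 < dens v ∧ ien v = 0 ∧ dens v ≤ ρs)) →
        reducedRHS (cutEOS σ η₁) (clamp a b) (pdAt T ρ u θ (s, x)) (dens v) (ien v) (mom v) ≤
          C * (pdAt T ρ u θ (s, x)).relEnergyZ (cutEOS σ η₁) (clamp a b) v := by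
  have hIcc : Icc 0 τ ⊆ Ico 0 T := fun t ht => ⟨ht.1, ht.2.trans_lt hτ.2⟩
  have hη₁ := S.2.2.1
  have hη₁₀ : η₁ < η₀ := sx_band_lt S
  have hσ := S.2.2.2.2.2.1
  have hG := S.2.2.2.2.2.2.2.1
  obtain ⟨hab, ⟨δ, hδ, hboxδ⟩, hdeep⟩ := hadm
  -- the compact thermo range `K`
  obtain ⟨hK, hKq⟩ := (sx_sol_cut S).isCompact_range_thermo hτ.2
  set K := (fun z : ℝ × T3 => (ρ z.1 z.2, θ z.1 z.2)) '' (Icc 0 τ ×ˢ univ) with hKdef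
  have hmemK : ∀ s ∈ Icc 0 τ, ∀ x, (ρ s x, θ s x) ∈ K := fun s hs x => ⟨(s, x), ⟨hs, mem_univ _⟩, rfl⟩
  have hKel : ∀ q ∈ K, ∃ s ∈ Icc 0 τ, ∃ x, q = (ρ s x, θ s x) := by
    rintro q ⟨⟨s, x⟩, ⟨hs, -⟩, rfl⟩; exact ⟨s, hs, x, rfl⟩
  have hKband : K ⊆ {q | 0 < q.1 ∧ q.1 * σ ^ 3 < η₁ ∧ 0 < q.2} := by
    intro q hq; obtain ⟨s, hs, x, rfl⟩ := hKel q hq; exact sx_band S (hIcc hs) x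
  have hdeepK : ∀ q ∈ K, (cutEOS σ η₁).chemPotential q.1 q.2 + q.2 * a ≤ -1 := by
    intro q hq; obtain ⟨s, hs, x, rfl⟩ := hKel q hq; exact hdeep s hs x
  -- bound on the point data and the strong bounds
  obtain ⟨M, hM0, hM⟩ := (sx_sol_cut S).exists_bound_pointData hτ.2
  obtain ⟨B, hB0, hbd⟩ := ia_strong_bounds S hτ
  -- BF master constant on vacuum / hot states
  obtain ⟨CM, hCM, hmasterM⟩ := HM K hK hKband M hM0 a b hab
    ⟨δ, hδ, fun r Θ r' ϑ' hq hr' hϑ' => by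
      obtain ⟨s, hs, x, hq'⟩ := hKel _ hq
      simp only [Prod.mk.injEq] at hq'
      obtain ⟨rfl, rfl⟩ := hq'
      exact hboxδ s hs x r' ϑ' hr' hϑ'⟩
    (fun r Θ hq => hdeepK (r, Θ) hq)
  -- nonnegativity of the clamped energy on `K`
  obtain ⟨Cc, ρs₁, _, hρs₁, hcoer⟩ := co_coercive_on_compact S.1 S.2.1 hη₁ hη₁₀ hσ hW' hZ1 hZpos hK hKq hab.le
    hB0 hdeepK
  -- constants of the frozen estimate
  obtain ⟨rmin, hrmin, hrminle⟩ : ∃ rmin : ℝ, 0 < rmin ∧ ∀ q ∈ K, rmin ≤ q.1 :=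
    hK.exists_forall_le' continuousOn_fst fun q hq => (hKq hq).1
  obtain ⟨S₀, hS₀0, hS₀⟩ := exists_nonneg_forall_abs_le_of_continuousOn hK
    ((hG.2.2.1.continuousOn (s := Ioi 0 ×ˢ Ioi 0)).mono hKq)
  obtain ⟨S₁, hS₁0, hS₁⟩ := exists_nonneg_forall_abs_le_of_continuousOn hK
    ((continuousOn_deriv_slice_fst hG.1 isOpen_quadrant le_rfl).mono hKq)
  obtain ⟨S₂, hS₂0, hS₂⟩ := exists_nonneg_forall_abs_le_of_continuousOn hK
    ((continuousOn_deriv_slice_snd hG.1 isOpen_quadrant le_rfl).mono hKq)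
  obtain ⟨pmin, hpmin, hpminle⟩ : ∃ pmin : ℝ, 0 < pmin ∧
      ∀ q ∈ K, pmin ≤ uncurry (EulerEOS.monatomicExcess χ f).p q :=
    hK.exists_forall_le' (hG.1.continuousOn.mono hKq) fun q hq => by
      obtain ⟨hr, hrb, hΘ⟩ := hKband hq
      obtain ⟨hχ, -⟩ := sx_agree_at S hr hrb
      have hZ : 0 < cutCompressibility η₁ (q.1 * σ ^ 3) := hZpos _ (by positivity)
      rw [hχ] at hZ
      show 0 < q.1 * q.2 * χ q.1
      positivity
  set Amax := max |a| |b| with hAmax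
  have hAmax0 : 0 ≤ Amax := le_max_of_le_left (abs_nonneg a)
  obtain ⟨ρs₂, hρs₂, hρs₂'⟩ : ∃ ρs₂ : ℝ, 0 < ρs₂ ∧ ρs₂ * (B + B * max |a| |b|) ≤ pmin / 2 := by
    refine ⟨pmin / (2 * (B + B * Amax + 1)), by positivity, ?_⟩
    rw [div_mul_eq_mul_div, div_le_div_iff₀ (by positivity) (by norm_num)]
    nlinarith [hB0, hAmax0, hpmin]
  obtain ⟨CF, hCF⟩ : ∃ CF : ℝ, ∀ (d : StrongPointData) (w : EulerPhase), rmin ≤ d.r → d.Bounded M →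
      |(cutEOS σ η₁).p d.r d.Θ| ≤ B → |(cutEOS σ η₁).s d.r d.Θ| ≤ S₀ + S₁ + S₂ →
      |d.pρ (cutEOS σ η₁)| ≤ S₀ + S₁ + S₂ → |d.pϑ (cutEOS σ η₁)| ≤ S₀ + S₁ + S₂ →
      |(cutEOS σ η₁).chemPotential d.r d.Θ| ≤ B → 0 ≤ d.Θ → d.Θ ≤ B → pmin ≤ (cutEOS σ η₁).p d.r d.Θ →
      0 < dens w → ien w = 0 → dens w ≤ ρs₂ →
        reducedRHS (cutEOS σ η₁) (clamp a b) d (dens w) (ien w) (mom w) ≤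
          CF * d.relEnergyZ (cutEOS σ η₁) (clamp a b) w :=
    ⟨_, fun d w hr hBd hpk hsk hpρ hpϑ hμ hΘ0 hΘ hp hρ hE hρs =>
      sx_reduced_le_frozen hM0 hrmin hr hBd hab.le hpk hsk hpρ hpϑ hμ hΘ0 hΘ hpmin hp hρs₂.le hρs₂' hρ hE hρs⟩
  -- nonnegativity of CF is not needed: we use `max CM CF` and `0 ≤ ℰ_Z`
  refine ⟨max CM CF, min ρs₁ ρs₂, le_max_of_le_left hCM.le, lt_min hρs₁ hρs₂, fun s hs x v hv => ?_⟩
  have hs' := hIcc hs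
  have hdK : ((pdAt T ρ u θ (s, x)).r, (pdAt T ρ u θ (s, x)).Θ) ∈ K := hmemK s hs x
  obtain ⟨hmass, -, htemp⟩ := sx_pd_eqs S hs' x
  have hBd : (pdAt T ρ u θ (s, x)).Bounded M := hM s hs x
  obtain ⟨huB, hμB, hθB, hpB⟩ := hbd s hs x
  -- nonnegativity of the clamped energy at `v`
  have hX : 0 ≤ (pdAt T ρ u θ (s, x)).relEnergyZ (cutEOS σ η₁) (clamp a b) v := by
    have hv' : v = 0 ∨ (0 < dens v ∧ 0 < ien v) ∨ (0 < dens v ∧ ien v = 0 ∧ dens v ≤ ρs₁) := by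
      rcases hv with h | h | ⟨h1, h2, h3⟩
      · exact Or.inl h
      · exact Or.inr (Or.inl h)
      · exact Or.inr (Or.inr ⟨h1, h2, h3.trans (min_le_left _ _)⟩)
    rw [sx_relEnergyZ_pdAt]
    exact (hcoer (ρ s x) (θ s x) (u s x) (hmemK s hs x) huB v hv').1
  rcases hv with h | h | ⟨h1, h2, h3⟩
  · exact (hmasterM _ hdK hBd hmass htemp v (Or.inl h)).trans (mul_le_mul_of_nonneg_right (le_max_left _ _) hX)
  · exact (hmasterM _ hdK hBd hmass htemp v (Or.inr h)).trans (mul_le_mul_of_nonneg_right (le_max_left _ _) hX)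
  · -- small frozen box
    obtain ⟨hp, hsB, hpρ, hpϑ, -, -⟩ := sx_pd_transfer S hs' x
    have h0 := hS₀ _ hdK
    have h1' := hS₁ _ hdK
    have h2' := hS₂ _ hdK
    simp only [uncurry] at h0 h1' h2'
    have hsk : |(cutEOS σ η₁).s (pdAt T ρ u θ (s, x)).r (pdAt T ρ u θ (s, x)).Θ| ≤ S₀ + S₁ + S₂ := by
      rw [hsB]; linarith
    have hpρ' : |(pdAt T ρ u θ (s, x)).pρ (cutEOS σ η₁)| ≤ S₀ + S₁ + S₂ := by
      rw [hpρ]; simp only [StrongPointData.pρ] at h1' ⊢; linarith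
    have hpϑ' : |(pdAt T ρ u θ (s, x)).pϑ (cutEOS σ η₁)| ≤ S₀ + S₁ + S₂ := by
      rw [hpϑ]; simp only [StrongPointData.pϑ] at h2' ⊢; linarith
    have hΘ0 : 0 ≤ (pdAt T ρ u θ (s, x)).Θ := (sx_band S hs' x).2.2.le
    have hΘB : (pdAt T ρ u θ (s, x)).Θ ≤ B := (le_abs_self _).trans hθB
    have hpmin' : pmin ≤ (cutEOS σ η₁).p (pdAt T ρ u θ (s, x)).r (pdAt T ρ u θ (s, x)).Θ := by
      rw [hp]; exact hpminle _ hdK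
    exact (hCF _ v (hrminle _ hdK) hBd hpB hsk hpρ' hpϑ' hμB hΘ0 hΘB hpmin' h1 h2 (h3.trans (min_le_right _ _))).trans
      (mul_le_mul_of_nonneg_right (le_max_right _ _) hX)

end Strong

end Summit.AtomisticToContinuum.HydrodynamicLimit.Theorems.RES

end
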